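import Summits.BirchSwinnertonDyer.Rank1Residual.Additive.PsiThreeHenselRootSign
import Summits.BirchSwinnertonDyer.Rank1Residual.Additive.WildThreeResidualShapeLaws
import Summits.BirchSwinnertonDyer.Rank1Residual.Additive.LocIrrValuationCriterionThreeProofs
import HarnessLib

/-!
# V10-SHAPE, TOOL (part 2 of 2): the side and the sign of the UNIQUE stable line of `W[3]|G_{ℚ₃}`
# are read off `c₆` — `v₃ Ψ₂²(x₀) = v₃(c₆) − 3` and `unit part of Ψ₂²(x₀) ≡ unit part of c₆ (mod 3)`
# (cell `b2b-bsdres`, cross-cell pool item of the x11b3 lineage p8 for the O6 lane's vocabulary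
#  `Additive/WildThreeResidualShape.lean`; theorems only, 0 defs / 0 facts / 0 `@[conjecture]`)

HONEST FRAMING (cell `b2b-bsdres`, run/shared/lean/b2b/bsd-rank1-residual/, verbatim in every file):
the goal of the cell is to DELETE the COMBINATION-SHAPED residual classes of the Birch–Swinnerton-Dyer
formula for ALL analytic-rank `≤ 1` elliptic curves over `ℚ` — "full BSD formula for every rank `≤ 1`
curve in class `C`" assembled STRICTLY from published theorems — so that the rank-`≤ 1` remainder
becomes exactly the CONSTRUCTION-SHAPED classes, which are TYPED (missing-input `Prop`s), NOT
attempted. This is not "finishing BSD". This file: THEOREMS ONLY (no definition, no named fact, no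
`@[conjecture]` node, no `sorry`; net named-fact debt `0`) about the census-decidable shape
predicates of `Additive/WildThreeResidualShape.lean`; nothing about any particular curve is asserted;
census counts stay EVIDENCE; nothing is booked; no mark of `RESIDUAL-MAP.md` moves; O6 stays OPEN.

## What is proved (every elliptic `W/ℚ`, ANY Weierstrass model, no reduction hypothesis)

Write `F(x₀) := Ψ₂²(x₀) = stableLineSignThree W x₀` for the sign of the stable line through a
`ℚ₃`-root `x₀` of `Ψ₃` (`Additive/WildThreeResidualShape.lean` §2: its square class in `ℚ₃ˣ/(ℚ₃ˣ)²`
is the quadratic character by which `G_{ℚ₃}` acts on the line). If `Ψ₃` has EXACTLY ONE root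
`x₀ ∈ ℚ₃` (`IsUniqueStableLineThree W x₀`: the shapes ET1 / ETM / ORD1 / ORDM), then

* `stableLineSignThree_eq_c₆_mul`: `c₆(W) ≠ 0` and `F(x₀) = (−1/216)·c₆·w` with `‖w − 1‖₃ < 1`;
* `valuation_stableLineSignThree`: `F(x₀) ≠ 0` and `v₃ F(x₀) = v₃(c₆) − 3`;
* `unitPartCongThree_stableLineSignThree_iff`: the unit part of `F(x₀)` is `≡ ε (mod 3)` iff the
  unit part of `c₆` is;
* the DICTIONARY on the one-stable-line locus (hypothesis `∃ x₀, IsUniqueStableLineThree W x₀`):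
  `shapeOrdSideThree_iff_even : ShapeOrdSideThree W ↔ Even (v₃ c₆)`,
  `shapeEtSideThree_iff_odd : ShapeEtSideThree W ↔ Odd (v₃ c₆)`, and
  `ORD1 ↔ Even ∧ c₆′ ≡ −1`, `ORDM ↔ Even ∧ c₆′ ≡ 1`, `ET1 ↔ Odd ∧ c₆′ ≡ 1`, `ETM ↔ Odd ∧ c₆′ ≡ −1`
  (`c₆′` = unit part of `c₆`, `UnitPartCongThree (W.c₆ : ℚ_[3]) (±1)`);
* §6 `wildThreeResidualShapeByKodaira_iff_even_c₆`: o6-r1's SHAPE LAW node is EQUIVALENT to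
  "for `W ∈ O6` with a unique stable line, `Kod₃ ∈ S(v₃N) ⟺ v₃(c₆)` even" (the law stays a node);
  `numStableLinesAtThree_eq_one_iff`: the census column `nroots = 1` IS `∃ x₀, IsUniqueStableLineThree W x₀`.

ROUTE. `W.toShortNF` has `u = 1`, so `c₆` is unchanged and `Ψ₃`, `Ψ₂²` over `ℚ₃` are SHIFTED by
`r` (§3): unique stable lines and signs correspond. On the short model `Ψ₃ = 3x⁴ + 6Ax² + 12Bx − A²`,
`F = 4x³ + 4Ax + 4B`, `c₆ = −864B`; a `ℚ₃`-root exists iff `A = 0` (then `x₀ = 0`, `F(0) = 4B`) or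
`B ≠ 0 ∧ 2v₃B + 2 ≤ 3v₃A` (E89's `psi3_exists_root_iff`), when part 1's Hensel root of valuation
`2v₃A − v₃B − 1` IS `x₀` by uniqueness and `F(x₀) = 4B(1 + t)`, `‖t‖₃ < 1`; finally `4B = (−1/216)·c₆`
with `−1/216` of valuation `−3` and unit part `≡ 1`. Uniqueness is load-bearing: on a SPLIT row the
second root carries the other parity (`s ⊕ sω`).

WHAT IT BUYS (the O6 lane's reading governs): on one-root rows the SHAPE LAW
`WildThreeResidualShapeByKodaira` (o6-r1 V10) reads "`v₃(c₆)` EVEN exactly on `S(v₃N)`" (§6), which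
is the `c₆` column of Kraus / Rizzo Table II on the wild cells (`v₃ c₆` even on IV* `(4,6,9)`,
`(≥5,6,9)`, `(4,6,10)`, II* `(4,6,11)`, `(5,8,12)`, `(≥6,8,13)`, II `(≥3,4,5)`; odd on II `(≥2,3,3)`,
`(2,3,4)`, IV `(2,3,5)`, `(3,5,6)`, `(≥4,5,7)`, IV* `(≥5,7,11)`; `(2,4,3)`, `(4,7,9)` are IRR) — 13/13
rows; the law itself stays `@[conjecture]` (its Kodaira / `condExp` columns are Tate's algorithm).

References: J.-P. Serre, Invent. Math. 15 (1972) §1.11 (local shapes of `E[p]`) [Serre1972];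
J. E. Cremona, *Algorithms for Modular Elliptic Curves* (1997) §3.8 [Cremona1997]; O. Rizzo,
Compositio Math. 136 (2003) Table II [Rizzo2003]; A. Kraus, Manuscripta Math. 69 (1990) [Kraus1990];
cell files `Additive/WildThreeResidualShape.lean` / `…Laws.lean` (o6-r1 GEN 10, cc-typer-5 GEN 7),
`Additive/PsiThreeNewtonPolygon.lean` + `Additive/LocIrrValuationCriterionThreeProofs.lean`
(harvest-2 GEN 42, E89), `Additive/PsiThreeHenselRootSign.lean` (part 1).
-/

set_option autoImplicit false

noncomputable section

open scoped Classical

open Polynomial WeierstrassCurve Literature.NumberTheory.EllipticCurves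
  Literature.NumberTheory.EllipticCurves.Rank1Residual
  Literature.NumberTheory.EllipticCurves.Rank1Residual.Typed
  Literature.NumberTheory.DiophantineGeometry

namespace Summit.BirchSwinnertonDyer.Rank1Residual.Additive

/-! ## §3 The short model, and the shift to it (`W.toShortNF` has `u = 1`) -/

section ShortNF

variable (S : WeierstrassCurve ℚ) [S.IsShortNF]

/-- `Ψ₂²` of a short model `y² = x³ + Ax + B` over `ℚ₃`: `4x³ + 4Ax + 4B`. [cite: Cremona1997, §3.8] -/
theorem eval_Ψ₂Sq_baseChange_of_isShortNF (x : ℚ_[3]) :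
    ((S.baseChange ℚ_[3]).Ψ₂Sq).eval x =
      4 * x ^ 3 + 4 * (S.a₄ : ℚ_[3]) * x + 4 * (S.a₆ : ℚ_[3]) := by
  simp only [WeierstrassCurve.baseChange, Ψ₂Sq, b₂, b₄, b₆, map_a₁, map_a₂, map_a₃, map_a₄, map_a₆,
    S.a₁_of_isShortNF, S.a₂_of_isShortNF, S.a₃_of_isShortNF, map_zero, eq_ratCast, eval_add, eval_mul,
    eval_pow, eval_C, eval_X]
  ring

/-- **The sign on a short model.** If `x₀` is the UNIQUE `ℚ₃`-root of `Ψ₃` of an elliptic short model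
`S : y² = x³ + Ax + B`, then `B ≠ 0` and `Ψ₂²(x₀) = 4B(1 + t)` with `‖t‖₃ < 1`. [folklore] -/
theorem stableLineSignThree_of_isShortNF [S.IsElliptic] {x₀ : ℚ_[3]}
    (hx : IsUniqueStableLineThree S x₀) :
    S.a₆ ≠ 0 ∧ ∃ t : ℚ_[3], ‖t‖ < 1 ∧
      stableLineSignThree S x₀ = 4 * (S.a₆ : ℚ_[3]) * (1 + t) := by
  have hroot := hx.1
  rw [IsRoot.def, eval_Ψ₃_baseChange_of_isShortNF] at hroot
  have hΔ : S.a₄ = 0 → S.a₆ ≠ 0 := by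
    intro hA hB
    have h := S.Δ'.ne_zero
    rw [coe_Δ', Δ_of_isShortNF, hA, hB] at h
    norm_num at h
  unfold stableLineSignThree
  rw [eval_Ψ₂Sq_baseChange_of_isShortNF]
  by_cases hA : S.a₄ = 0
  · -- `A = 0`: `0` is a root, hence `x₀ = 0` and `F(0) = 4B`
    have hB := hΔ hA
    have h0 : ((S.baseChange ℚ_[3]).Ψ₃).IsRoot 0 := by
      rw [IsRoot.def, eval_Ψ₃_baseChange_of_isShortNF, hA]; push_cast; ring
    have hx0 : x₀ = 0 := (hx.2 0 h0).symm
    refine ⟨hB, 0, by simp, ?_⟩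
    rw [hx0, hA]; push_cast; ring
  · -- `A ≠ 0`: the root criterion, the Hensel root with its valuation, uniqueness, dominance
    obtain ⟨hB, hlt⟩ := (PsiThreeAdic.psi3_exists_root_iff (B := S.a₆) hA).mp ⟨x₀, hroot⟩
    obtain ⟨z, hz0, hzv, hz⟩ := PsiThreeAdic.psi3_exists_root_valuation_of_lt hA hB hlt
    have hzroot : ((S.baseChange ℚ_[3]).Ψ₃).IsRoot z := by
      rw [IsRoot.def, eval_Ψ₃_baseChange_of_isShortNF]; exact hz
    have hxz : x₀ = z := (hx.2 z hzroot).symm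
    subst hxz
    obtain ⟨t, ht, hF⟩ := PsiThreeAdic.psi2Sq_eq_of_valuation hA hB hlt hz0 hzv
    exact ⟨hB, t, ht, hF⟩

end ShortNF

section Shift

variable (W : WeierstrassCurve ℚ) (C : VariableChange ℚ)

/-- A change of variables with `u = 1` SHIFTS `Ψ₃` over `ℚ₃`: `Ψ₃^{C•W}(x) = Ψ₃^{W}(x + r)`. [folklore] -/
theorem eval_Ψ₃_baseChange_smul_of_u_eq_one (hu : C.u = 1) (x : ℚ_[3]) :
    (((C • W).baseChange ℚ_[3]).Ψ₃).eval x = ((W.baseChange ℚ_[3]).Ψ₃).eval (x + (C.r : ℚ_[3])) := by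
  simp only [WeierstrassCurve.baseChange, Ψ₃, map_b₂, map_b₄, map_b₆, map_b₈, variableChange_b₂,
    variableChange_b₄, variableChange_b₆, variableChange_b₈, hu, inv_one, Units.val_one, one_pow,
    one_mul, eq_ratCast, eval_add, eval_mul, eval_pow, eval_C, eval_X, eval_ofNat]
  push_cast; ring

/-- A change of variables with `u = 1` SHIFTS `Ψ₂²` over `ℚ₃`: `Ψ₂²^{C•W}(x) = Ψ₂²^{W}(x + r)`. [folklore] -/
theorem eval_Ψ₂Sq_baseChange_smul_of_u_eq_one (hu : C.u = 1) (x : ℚ_[3]) :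
    (((C • W).baseChange ℚ_[3]).Ψ₂Sq).eval x =
      ((W.baseChange ℚ_[3]).Ψ₂Sq).eval (x + (C.r : ℚ_[3])) := by
  simp only [WeierstrassCurve.baseChange, Ψ₂Sq, map_b₂, map_b₄, map_b₆, variableChange_b₂,
    variableChange_b₄, variableChange_b₆, hu, inv_one, Units.val_one, one_pow, one_mul, eq_ratCast,
    eval_add, eval_mul, eval_pow, eval_C, eval_X]
  push_cast; ring

/-- The stable-line sign is shift-invariant: `F^{C•W}(x) = F^{W}(x + r)` for `u = 1`. [folklore] -/
theorem stableLineSignThree_smul_of_u_eq_one (hu : C.u = 1) (x : ℚ_[3]) :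
    stableLineSignThree (C • W) x = stableLineSignThree W (x + (C.r : ℚ_[3])) :=
  eval_Ψ₂Sq_baseChange_smul_of_u_eq_one W C hu x

/-- Unique stable lines correspond under the shift: `x₀` for `C • W` iff `x₀ + r` for `W`. [folklore] -/
theorem isUniqueStableLineThree_smul_iff_of_u_eq_one (hu : C.u = 1) (x₀ : ℚ_[3]) :
    IsUniqueStableLineThree (C • W) x₀ ↔ IsUniqueStableLineThree W (x₀ + (C.r : ℚ_[3])) := by
  simp only [IsUniqueStableLineThree, IsRoot.def, eval_Ψ₃_baseChange_smul_of_u_eq_one W C hu]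
  constructor
  · rintro ⟨h0, huniq⟩
    refine ⟨h0, fun r hr ↦ ?_⟩
    have := huniq (r - (C.r : ℚ_[3])) (by rwa [sub_add_cancel])
    rw [← this, sub_add_cancel]
  · rintro ⟨h0, huniq⟩
    refine ⟨h0, fun r hr ↦ ?_⟩
    have := huniq (r + (C.r : ℚ_[3])) hr
    exact add_right_cancel this

/-- `W.toShortNF` has `u = 1` (= the tree's `Literature.NumberTheory.EllipticCurves.toShortNF_u`,
re-proved in two lines to keep the import closure small). [folklore] -/
private theorem toShortNF_u_eq_one : W.toShortNF.u = 1 := by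
  rw [toShortNF, VariableChange.mul_def]
  simp [toCharNeTwoNF]

end Shift

/-! ## §4 HEADLINE: the sign of the unique stable line is `(−1/216)·c₆`, up to a principal unit -/

section Headline

variable (W : WeierstrassCurve ℚ) [W.IsElliptic]

/-- **`F(x₀) = (−1/216)·c₆·w`, `‖w − 1‖₃ < 1`, and `c₆ ≠ 0`**, for the unique `ℚ₃`-root `x₀` of `Ψ₃`
of ANY model `W` of an elliptic curve over `ℚ` (shift to `W.toShortNF • W`, `u = 1`). [cite: Serre1972, §1.11] -/
theorem stableLineSignThree_eq_c₆_mul {x₀ : ℚ_[3]} (hx : IsUniqueStableLineThree W x₀) :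
    W.c₆ ≠ 0 ∧ ∃ w : ℚ_[3], ‖w - 1‖ < 1 ∧
      stableLineSignThree W x₀ = (-1 / 216 : ℚ_[3]) * (W.c₆ : ℚ_[3]) * w := by
  set C := W.toShortNF with hC
  have hu : C.u = 1 := toShortNF_u_eq_one W
  haveI : (C • W).IsShortNF := W.toShortNF_spec
  haveI : (C • W).IsElliptic := by rw [hC]; infer_instance
  -- the shifted root is the unique stable line of the short model
  have hx' : IsUniqueStableLineThree (C • W) (x₀ - (C.r : ℚ_[3])) := by
    rw [isUniqueStableLineThree_smul_iff_of_u_eq_one W C hu, sub_add_cancel]; exact hx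
  obtain ⟨hB, t, ht, hF⟩ := stableLineSignThree_of_isShortNF (C • W) hx'
  have hc₆ : (C • W).c₆ = W.c₆ := by
    rw [variableChange_c₆, hu, inv_one, Units.val_one, one_pow, one_mul]
  have hc₆' : W.c₆ = -864 * (C • W).a₆ := by rw [← hc₆, c₆_of_isShortNF]
  refine ⟨by rw [hc₆']; exact mul_ne_zero (by norm_num) hB, 1 + t, by simpa using ht, ?_⟩
  rw [← sub_add_cancel x₀ (C.r : ℚ_[3]), ← stableLineSignThree_smul_of_u_eq_one W C hu, hF, hc₆']
  push_cast
  ring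

/-- **`F(x₀) ≠ 0` and `v₃ F(x₀) = v₃(c₆) − 3`** for the unique stable line. [cite: Serre1972, §1.11] -/
theorem valuation_stableLineSignThree {x₀ : ℚ_[3]} (hx : IsUniqueStableLineThree W x₀) :
    stableLineSignThree W x₀ ≠ 0 ∧
      (stableLineSignThree W x₀).valuation = padicValRat 3 W.c₆ - 3 := by
  obtain ⟨hc₆, w, hw, hF⟩ := stableLineSignThree_eq_c₆_mul W hx
  obtain ⟨hw0, hwv⟩ := PsiThreeAdic.valuation_eq_zero_of_norm_sub_one_lt hw
  obtain ⟨hk0, hkv, -⟩ := unitPartThree_const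
  have hc₆' : (W.c₆ : ℚ_[3]) ≠ 0 := by exact_mod_cast hc₆
  refine ⟨by rw [hF]; exact mul_ne_zero (mul_ne_zero hk0 hc₆') hw0, ?_⟩
  rw [hF, Padic.valuation_mul (mul_ne_zero hk0 hc₆') hw0, Padic.valuation_mul hk0 hc₆', hkv, hwv,
    Padic.valuation_ratCast]
  ring

/-- **The unit part of `F(x₀)` is `≡ ε (mod 3)` iff the unit part of `c₆` is** (any `ε`; used
for `ε = ±1`). [cite: Serre1972, §1.11] -/
theorem unitPartCongThree_stableLineSignThree_iff {x₀ : ℚ_[3]} (hx : IsUniqueStableLineThree W x₀)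
    (ε : ℚ_[3]) :
    UnitPartCongThree (stableLineSignThree W x₀) ε ↔ UnitPartCongThree (W.c₆ : ℚ_[3]) ε := by
  obtain ⟨hc₆, w, hw, hF⟩ := stableLineSignThree_eq_c₆_mul W hx
  obtain ⟨hw0, -⟩ := PsiThreeAdic.valuation_eq_zero_of_norm_sub_one_lt hw
  obtain ⟨hk0, -, hkγ⟩ := unitPartThree_const
  have hc₆' : (W.c₆ : ℚ_[3]) ≠ 0 := by exact_mod_cast hc₆
  have hwγ : ‖unitPartThree w - 1‖ < 1 := by rwa [unitPartThree_of_norm_sub_one_lt hw]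
  rw [hF, mul_assoc, unitPartCongThree_mul_iff hk0 (mul_ne_zero hc₆' hw0) hkγ, mul_comm,
    unitPartCongThree_mul_iff hw0 hc₆' hwγ]

end Headline

/-! ## §5 The dictionary: the six one-line shapes on the one-stable-line locus, by `c₆` -/

section Dictionary

variable (W : WeierstrassCurve ℚ) [W.IsElliptic]

/-- **ORD-side ⟺ `v₃(c₆)` EVEN** (on the one-stable-line locus). [cite: Serre1972, §1.11] -/
theorem shapeOrdSideThree_iff_even (h1 : ∃ x₀, IsUniqueStableLineThree W x₀) :
    ShapeOrdSideThree W ↔ Even (padicValRat 3 W.c₆) := by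
  constructor
  · rintro (⟨x₀, hx, -, hodd, -⟩ | ⟨x₀, hx, -, hodd, -⟩) <;>
    · rw [(valuation_stableLineSignThree W hx).2] at hodd
      rcases hodd with ⟨k, hk⟩
      exact ⟨k + 2, by omega⟩
  · intro hev
    obtain ⟨x₀, hx⟩ := h1
    obtain ⟨hne, hv⟩ := valuation_stableLineSignThree W hx
    have hodd : Odd (stableLineSignThree W x₀).valuation := by
      rw [hv]; rcases hev with ⟨k, hk⟩; exact ⟨k - 2, by omega⟩
    rcases unitPartCongThree_one_or_neg_one hne with h | h
    · exact Or.inr ⟨x₀, hx, hne, hodd, h⟩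
    · exact Or.inl ⟨x₀, hx, hne, hodd, h⟩

/-- **ET-side ⟺ `v₃(c₆)` ODD** (on the one-stable-line locus). [cite: Serre1972, §1.11] -/
theorem shapeEtSideThree_iff_odd (h1 : ∃ x₀, IsUniqueStableLineThree W x₀) :
    ShapeEtSideThree W ↔ Odd (padicValRat 3 W.c₆) := by
  constructor
  · rintro (⟨x₀, hx, -, hev, -⟩ | ⟨x₀, hx, -, hev, -⟩) <;>
    · rw [(valuation_stableLineSignThree W hx).2] at hev
      rcases hev with ⟨k, hk⟩
      exact ⟨k + 1, by omega⟩
  · intro hodd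
    obtain ⟨x₀, hx⟩ := h1
    obtain ⟨hne, hv⟩ := valuation_stableLineSignThree W hx
    have hev : Even (stableLineSignThree W x₀).valuation := by
      rw [hv]; rcases hodd with ⟨k, hk⟩; exact ⟨k - 1, by omega⟩
    rcases unitPartCongThree_one_or_neg_one hne with h | h
    · exact Or.inl ⟨x₀, hx, hne, hev, h⟩
    · exact Or.inr ⟨x₀, hx, hne, hev, h⟩

/-- **ORD1 ⟺ `v₃(c₆)` even and unit part of `c₆` `≡ −1 (mod 3)`** (line `≅ μ₃`: anomalous good
ordinary, split multiplicative, …). [cite: Serre1972, §1.11] -/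
theorem shapeORD1Three_iff (h1 : ∃ x₀, IsUniqueStableLineThree W x₀) :
    ShapeORD1Three W ↔ Even (padicValRat 3 W.c₆) ∧ UnitPartCongThree (W.c₆ : ℚ_[3]) (-1) := by
  constructor
  · rintro ⟨x₀, hx, hne, hodd, hu⟩
    refine ⟨(shapeOrdSideThree_iff_even W h1).mp (Or.inl ⟨x₀, hx, hne, hodd, hu⟩), ?_⟩
    exact (unitPartCongThree_stableLineSignThree_iff W hx (-1)).mp hu
  · rintro ⟨hev, hu⟩
    obtain ⟨x₀, hx⟩ := h1
    obtain ⟨hne, hv⟩ := valuation_stableLineSignThree W hx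
    refine ⟨x₀, hx, hne, ?_, (unitPartCongThree_stableLineSignThree_iff W hx (-1)).mpr hu⟩
    rw [hv]; rcases hev with ⟨k, hk⟩; exact ⟨k - 2, by omega⟩

/-- **ORDM ⟺ `v₃(c₆)` even and unit part of `c₆` `≡ 1 (mod 3)`** (line `≅ μ₃ ⊗` unramified
quadratic: non-anomalous good ordinary, non-split multiplicative, …). [cite: Serre1972, §1.11] -/
theorem shapeORDMThree_iff (h1 : ∃ x₀, IsUniqueStableLineThree W x₀) :
    ShapeORDMThree W ↔ Even (padicValRat 3 W.c₆) ∧ UnitPartCongThree (W.c₆ : ℚ_[3]) 1 := by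
  constructor
  · rintro ⟨x₀, hx, hne, hodd, hu⟩
    refine ⟨(shapeOrdSideThree_iff_even W h1).mp (Or.inr ⟨x₀, hx, hne, hodd, hu⟩), ?_⟩
    exact (unitPartCongThree_stableLineSignThree_iff W hx 1).mp hu
  · rintro ⟨hev, hu⟩
    obtain ⟨x₀, hx⟩ := h1
    obtain ⟨hne, hv⟩ := valuation_stableLineSignThree W hx
    refine ⟨x₀, hx, hne, ?_, (unitPartCongThree_stableLineSignThree_iff W hx 1).mpr hu⟩
    rw [hv]; rcases hev with ⟨k, hk⟩; exact ⟨k - 2, by omega⟩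

/-- **ET1 ⟺ `v₃(c₆)` odd and unit part of `c₆` `≡ 1 (mod 3)`** (the stable line is
`ℚ₃`-rational: local `3`-torsion). [cite: Serre1972, §1.11] -/
theorem shapeET1Three_iff (h1 : ∃ x₀, IsUniqueStableLineThree W x₀) :
    ShapeET1Three W ↔ Odd (padicValRat 3 W.c₆) ∧ UnitPartCongThree (W.c₆ : ℚ_[3]) 1 := by
  constructor
  · rintro ⟨x₀, hx, hne, hev, hu⟩
    refine ⟨(shapeEtSideThree_iff_odd W h1).mp (Or.inl ⟨x₀, hx, hne, hev, hu⟩), ?_⟩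
    exact (unitPartCongThree_stableLineSignThree_iff W hx 1).mp hu
  · rintro ⟨hodd, hu⟩
    obtain ⟨x₀, hx⟩ := h1
    obtain ⟨hne, hv⟩ := valuation_stableLineSignThree W hx
    refine ⟨x₀, hx, hne, ?_, (unitPartCongThree_stableLineSignThree_iff W hx 1).mpr hu⟩
    rw [hv]; rcases hodd with ⟨k, hk⟩; exact ⟨k - 1, by omega⟩

/-- **ETM ⟺ `v₃(c₆)` odd and unit part of `c₆` `≡ −1 (mod 3)`** (line acted on by the unramified
quadratic character). [cite: Serre1972, §1.11] -/
theorem shapeETMThree_iff (h1 : ∃ x₀, IsUniqueStableLineThree W x₀) :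
    ShapeETMThree W ↔ Odd (padicValRat 3 W.c₆) ∧ UnitPartCongThree (W.c₆ : ℚ_[3]) (-1) := by
  constructor
  · rintro ⟨x₀, hx, hne, hev, hu⟩
    refine ⟨(shapeEtSideThree_iff_odd W h1).mp (Or.inr ⟨x₀, hx, hne, hev, hu⟩), ?_⟩
    exact (unitPartCongThree_stableLineSignThree_iff W hx (-1)).mp hu
  · rintro ⟨hodd, hu⟩
    obtain ⟨x₀, hx⟩ := h1
    obtain ⟨hne, hv⟩ := valuation_stableLineSignThree W hx
    refine ⟨x₀, hx, hne, ?_, (unitPartCongThree_stableLineSignThree_iff W hx (-1)).mpr hu⟩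
    rw [hv]; rcases hodd with ⟨k, hk⟩; exact ⟨k - 1, by omega⟩

end Dictionary

/-! ## §6 What it buys: the SHAPE LAW `WildThreeResidualShapeByKodaira`, restated by `c₆` -/

section ShapeLaw

/-- **The V10 SHAPE LAW is a statement about the parity of `v₃(c₆)`.** o6-r1's `@[conjecture]`
node `WildThreeResidualShapeByKodaira` ("on O6, ORD-side iff `Kod₃ ∈ S(v₃N)`, ET-side otherwise") is
EQUIVALENT to: for every `W ∈ O6` with a unique stable line,
`Kod₃(W) ∈ S(v₃N) ⟺ v₃(c₆(W))` is even — by the dictionary of §5 (on rows without a unique stable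
line both laws are silent). Nothing is asserted about the law itself: it stays `@[conjecture]` (its
Kodaira / conductor-exponent columns are Tate's algorithm at a wild `3`); this only moves its content
onto the `c₆` column of the Kraus / Table II classification. [cite: Serre1972, §1.11]
[cite: Kraus1990, Théorème (p = 3)] -/
theorem wildThreeResidualShapeByKodaira_iff_even_c₆ :
    WildThreeResidualShapeByKodaira ↔
      ∀ (W : WeierstrassCurve ℚ) [W.IsElliptic] [W.IsGloballyMinimal], ClassO6 W 3 →
        (∃ x₀, IsUniqueStableLineThree W x₀) →
          (ordSideKodairaThree (condExp W 3) (W.kodairaSymbolAt (placeOf 3)) = true ↔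
            Even (padicValRat 3 W.c₆)) := by
  constructor
  · intro hlaw W _ _ hO6 h1
    obtain ⟨hord, het⟩ := hlaw W hO6
    constructor
    · intro htrue
      by_contra hne
      have hodd : Odd (padicValRat 3 W.c₆) := Int.not_even_iff_odd.mp hne
      have := het ((shapeEtSideThree_iff_odd W h1).mpr hodd)
      rw [this] at htrue
      exact Bool.false_ne_true htrue
    · intro hev
      exact hord ((shapeOrdSideThree_iff_even W h1).mpr hev)
  · intro h W _ _ hO6
    constructor
    · intro hOrd
      have h1 : ∃ x₀, IsUniqueStableLineThree W x₀ := by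
        rcases hOrd with ⟨x₀, hx, -⟩ | ⟨x₀, hx, -⟩ <;> exact ⟨x₀, hx⟩
      exact (h W hO6 h1).mpr ((shapeOrdSideThree_iff_even W h1).mp hOrd)
    · intro hEt
      have h1 : ∃ x₀, IsUniqueStableLineThree W x₀ := by
        rcases hEt with ⟨x₀, hx, -⟩ | ⟨x₀, hx, -⟩ <;> exact ⟨x₀, hx⟩
      have hodd := (shapeEtSideThree_iff_odd W h1).mp hEt
      cases hb : ordSideKodairaThree (condExp W 3) (W.kodairaSymbolAt (placeOf 3))
      · rfl
      · exact absurd ((h W hO6 h1).mp hb) (Int.not_even_iff_odd.mpr hodd)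

/-- **Dictionary with the census column `nroots`**: `O5.numStableLinesAtThree W = 1` iff `W` has a
unique stable line — so every theorem above reads on the rows with `nroots = 1`. [folklore] -/
theorem numStableLinesAtThree_eq_one_iff (W : WeierstrassCurve ℚ) :
    O5.numStableLinesAtThree W = 1 ↔ ∃ x₀, IsUniqueStableLineThree W x₀ := by
  have hbc : (W.baseChange ℚ_[3]).Ψ₃ = (W.Ψ₃).map (algebraMap ℚ ℚ_[3]) := by
    rw [WeierstrassCurve.baseChange, map_Ψ₃]
  have hne : (W.Ψ₃).map (algebraMap ℚ ℚ_[3]) ≠ 0 := by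
    rw [← hbc]; exact Ψ₃_ne_zero _ (by norm_num)
  have hmem : ∀ r, r ∈ ((W.Ψ₃).map (algebraMap ℚ ℚ_[3])).roots.toFinset ↔
      ((W.baseChange ℚ_[3]).Ψ₃).IsRoot r := by
    intro r; rw [Multiset.mem_toFinset, mem_roots hne, hbc]
  unfold O5.numStableLinesAtThree
  rw [Finset.card_eq_one]
  constructor
  · rintro ⟨x₀, hx₀⟩
    refine ⟨x₀, (hmem x₀).1 (by rw [hx₀]; exact Finset.mem_singleton_self _), fun r hr ↦ ?_⟩
    exact Finset.mem_singleton.1 (hx₀ ▸ (hmem r).2 hr)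
  · rintro ⟨x₀, hx, huniq⟩
    exact ⟨x₀, Finset.eq_singleton_iff_unique_mem.2 ⟨(hmem x₀).2 hx, fun r hr ↦ huniq r ((hmem r).1 hr)⟩⟩

end ShapeLaw

end Summit.BirchSwinnertonDyer.Rank1Residual.Additive

end
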